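import Mathlib.RingTheory.NoetherNormalization
import Mathlib.RingTheory.Localization.Integral
import Mathlib.RingTheory.Localization.Ideal
import Mathlib.RingTheory.RingHom.FiniteType
import Mathlib.RingTheory.IntegralClosure.IsIntegralClosure.Basic
import HarnessLib

/-!
# Generic-fibre localisation: a prime of a finite-type domain becomes maximal, of finite type over a field, after
# inverting the lifted Noether coordinates of its residue ring — §G0a of `GenericFibreSig`
# (crux `FInjectiveMacaulayfication` stmt-ResolutionOfSingularities-15315, chain w45a, holes #3β / 5e)

[OURS · L1 W4.5a · res-D-pv-019 AS res-L1-w45a-stub-7] Support file (`--supports stmt-ResolutionOfSingularities-15315 --as helper`)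
for the crux `FrobeniusLadder.FInjectiveMacaulayfication`; NOT a statement of any manuscript; AI-written, weaker than expert review.
Statement = §G0a `stub_genericFibreLocalization` of strat-1's `L/res-L1-w45a-strat-1/GenericFibreSig.lean` (sha16 5323a437c3c0f1a3,
evidence #43 on 15315) VERBATIM with `stub_` dropped. Pure Mathlib algebra.

THE THEOREM (`genericFibreLocalization`). `A` a domain of finite type over a field `k`, `𝔭` a prime: there is a multiplicative set
`M ⊆ A` disjoint from `𝔭` such that `𝔭·A[M⁻¹]` is MAXIMAL and `A[M⁻¹]` is of finite type over a field `K₀ ⊇ k`.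
PROOF. NOETHER NORMALISATION of `B = A/𝔭` (Mathlib `exists_integral_inj_algHom_of_fg`): `g : k[X₁..X_s] → B` injective with
`B` integral over it. Lift the coordinates to `t_i ∈ A` and let `G = aeval t : P = k[X] → A` (so `mk ∘ G = g`, `G` injective);
`M := G(P ∖ 0)` misses `𝔭` (injectivity of `g`); `K₀ := Frac P`. Then `A[M⁻¹]` is of finite type over `K₀` (Mathlib
`RingHom.finiteType_localizationPreserves`: localisation of the finite-type `P → A` at `P ∖ 0`), and
`A[M⁻¹]/𝔭A[M⁻¹] = B[M̄⁻¹]` (localisation commutes with quotients) is a DOMAIN (`g` injective) INTEGRAL over the field `K₀`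
(Mathlib `isIntegral_localization`), hence a field (`isField_of_isIntegral_of_isField'`): `𝔭A[M⁻¹]` is maximal.
Geometrically: the local ring at a point of dimension `s` is the local ring at a CLOSED point of the generic fibre over `𝔸^s`.
No named facts.
-/

-- single-problem summit: the doubled namespace component is forced
set_option linter.dupNamespace false

noncomputable section

namespace Summit.ResolutionOfSingularities.ResolutionOfSingularities.Theorems.FInjectiveMacaulayfication.GenericFibreLocalization

/-- **§G0a — GENERIC-FIBRE LOCALISATION** (`GenericFibreSig` §G0a `stub_genericFibreLocalization`, verbatim): Noether
normalisation of `A/𝔭`, lifted to `A`; invert the non-zero polynomials in the lifted coordinates. [folklore] -/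
theorem genericFibreLocalization : ∀ (k : Type) [Field k] (A : Type) [CommRing A] [IsDomain A] [Algebra k A],
    Algebra.FiniteType k A → ∀ (𝔭 : Ideal A), 𝔭.IsPrime →
      ∃ (M : Submonoid A), Disjoint (M : Set A) (𝔭 : Set A) ∧
        (Ideal.map (algebraMap A (Localization M)) 𝔭).IsMaximal ∧
        ∃ (K₀ : Type) (_ : Field K₀) (_ : Algebra k K₀) (_ : Algebra K₀ (Localization M)),
          Algebra.FiniteType K₀ (Localization M)  := by
  intro k _ A _ _ _ hft 𝔭 h𝔭
  classical
  haveI := h𝔭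
  haveI : Nontrivial (A ⧸ 𝔭) := Ideal.Quotient.nontrivial_iff.mpr h𝔭.ne_top
  haveI : Algebra.FiniteType k (A ⧸ 𝔭) := hft.of_surjective (Ideal.Quotient.mkₐ k 𝔭) (Ideal.Quotient.mkₐ_surjective k 𝔭)
  -- Noether normalisation of `A ⧸ 𝔭`, lifted to `A`
  obtain ⟨s, g, hginj, hgint⟩ := exists_integral_inj_algHom_of_fg k (A ⧸ 𝔭)
  choose t ht using fun i : Fin s => Ideal.Quotient.mk_surjective (I := 𝔭) (g (MvPolynomial.X i))
  let G : MvPolynomial (Fin s) k →ₐ[k] A := MvPolynomial.aeval t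
  have hGg : ∀ q, Ideal.Quotient.mk 𝔭 (G q) = g q := fun q => by
    have h : (Ideal.Quotient.mkₐ k 𝔭).comp G = g :=
      MvPolynomial.algHom_ext fun i => by
        rw [AlgHom.comp_apply, Ideal.Quotient.mkₐ_eq_mk]
        change Ideal.Quotient.mk 𝔭 (MvPolynomial.aeval t (MvPolynomial.X i)) = g (MvPolynomial.X i)
        rw [MvPolynomial.aeval_X, ht i]
    have h' := AlgHom.congr_fun h q
    rw [AlgHom.comp_apply, Ideal.Quotient.mkₐ_eq_mk] at h'
    exact h'
  -- `A` as an algebra over the polynomial ring `P`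
  letI : Algebra (MvPolynomial (Fin s) k) A := G.toRingHom.toAlgebra
  have halg : ∀ q, algebraMap (MvPolynomial (Fin s) k) A q = G q := fun q => rfl
  haveI : IsScalarTower k (MvPolynomial (Fin s) k) A :=
    IsScalarTower.of_algebraMap_eq fun c => by rw [halg, AlgHom.commutes]
  have halgB : ∀ q, algebraMap (MvPolynomial (Fin s) k) (A ⧸ 𝔭) q = g q := fun q => by
    rw [IsScalarTower.algebraMap_apply (MvPolynomial (Fin s) k) A (A ⧸ 𝔭), Ideal.Quotient.algebraMap_eq, halg, hGg]
  have hinjB : Function.Injective (algebraMap (MvPolynomial (Fin s) k) (A ⧸ 𝔭)) := fun a b h => by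
    rw [halgB, halgB] at h
    exact hginj h
  haveI : Algebra.IsIntegral (MvPolynomial (Fin s) k) (A ⧸ 𝔭) :=
    algebraMap_isIntegral_iff.mp fun x => by
      obtain ⟨p, hp, hpx⟩ := hgint x
      refine ⟨p, hp, ?_⟩
      rw [show algebraMap (MvPolynomial (Fin s) k) (A ⧸ 𝔭) = g.toRingHom from RingHom.ext halgB]
      exact hpx
  -- the multiplicative set: images of the non-zero polynomials
  refine ⟨(nonZeroDivisors (MvPolynomial (Fin s) k)).map (algebraMap (MvPolynomial (Fin s) k) A), ?_, ?_, ?_⟩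
  · -- disjoint from `𝔭`: a non-zero polynomial does not die in `A ⧸ 𝔭` (injectivity of `g`)
    refine Set.disjoint_left.mpr ?_
    rintro _ ⟨q, hq, rfl⟩ hx
    have h0 : g q = 0 := by
      rw [← hGg, Ideal.Quotient.eq_zero_iff_mem]
      exact hx
    exact nonZeroDivisors.ne_zero hq (hginj (by rw [h0, map_zero]))
  · -- `𝔭·A[M⁻¹]` is maximal: `A[M⁻¹] ⧸ 𝔭 = B[M̄⁻¹]` is a domain integral over the field `Frac P`
    haveI : IsDomain (A ⧸ 𝔭) := Ideal.Quotient.isDomain 𝔭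
    have hsub : Algebra.algebraMapSubmonoid (A ⧸ 𝔭)
        ((nonZeroDivisors (MvPolynomial (Fin s) k)).map (algebraMap (MvPolynomial (Fin s) k) A)) =
        Algebra.algebraMapSubmonoid (A ⧸ 𝔭) (nonZeroDivisors (MvPolynomial (Fin s) k)) := by
      ext x
      simp only [Algebra.algebraMapSubmonoid, Submonoid.mem_map]
      constructor
      · rintro ⟨_, ⟨q, hq, rfl⟩, rfl⟩
        exact ⟨q, hq, (IsScalarTower.algebraMap_apply (MvPolynomial (Fin s) k) A (A ⧸ 𝔭) q).symm⟩
      · rintro ⟨q, hq, rfl⟩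
        exact ⟨_, ⟨q, hq, rfl⟩, (IsScalarTower.algebraMap_apply (MvPolynomial (Fin s) k) A (A ⧸ 𝔭) q).symm⟩
    haveI hloc : IsLocalization (Algebra.algebraMapSubmonoid (A ⧸ 𝔭) (nonZeroDivisors (MvPolynomial (Fin s) k)))
        (Localization ((nonZeroDivisors (MvPolynomial (Fin s) k)).map (algebraMap (MvPolynomial (Fin s) k) A)) ⧸
          𝔭.map (algebraMap A (Localization ((nonZeroDivisors (MvPolynomial (Fin s) k)).map
            (algebraMap (MvPolynomial (Fin s) k) A))))) := by
      rw [← hsub]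
      infer_instance
    have hle : Algebra.algebraMapSubmonoid (A ⧸ 𝔭) (nonZeroDivisors (MvPolynomial (Fin s) k)) ≤
        nonZeroDivisors (A ⧸ 𝔭) :=
      map_le_nonZeroDivisors_of_injective _ hinjB le_rfl
    haveI : IsDomain (Localization ((nonZeroDivisors (MvPolynomial (Fin s) k)).map (algebraMap (MvPolynomial (Fin s) k) A)) ⧸
        𝔭.map (algebraMap A (Localization ((nonZeroDivisors (MvPolynomial (Fin s) k)).map
          (algebraMap (MvPolynomial (Fin s) k) A))))) :=
      IsLocalization.isDomain_of_le_nonZeroDivisors _ hle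
    have hint := isIntegral_localization (R := MvPolynomial (Fin s) k) (S := A ⧸ 𝔭)
      (M := nonZeroDivisors (MvPolynomial (Fin s) k)) (Rₘ := FractionRing (MvPolynomial (Fin s) k))
      (Sₘ := Localization ((nonZeroDivisors (MvPolynomial (Fin s) k)).map (algebraMap (MvPolynomial (Fin s) k) A)) ⧸
        𝔭.map (algebraMap A (Localization ((nonZeroDivisors (MvPolynomial (Fin s) k)).map
          (algebraMap (MvPolynomial (Fin s) k) A)))))
    have hQ : IsField (Localization ((nonZeroDivisors (MvPolynomial (Fin s) k)).map (algebraMap (MvPolynomial (Fin s) k) A)) ⧸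
        𝔭.map (algebraMap A (Localization ((nonZeroDivisors (MvPolynomial (Fin s) k)).map
          (algebraMap (MvPolynomial (Fin s) k) A))))) := by
      letI := (IsLocalization.map (Localization ((nonZeroDivisors (MvPolynomial (Fin s) k)).map
          (algebraMap (MvPolynomial (Fin s) k) A)) ⧸ 𝔭.map (algebraMap A (Localization ((nonZeroDivisors
            (MvPolynomial (Fin s) k)).map (algebraMap (MvPolynomial (Fin s) k) A)))))
        (algebraMap (MvPolynomial (Fin s) k) (A ⧸ 𝔭))
        (show _ ≤ (Algebra.algebraMapSubmonoid (A ⧸ 𝔭) (nonZeroDivisors (MvPolynomial (Fin s) k))).comap _ from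
          (nonZeroDivisors (MvPolynomial (Fin s) k)).le_comap_map) :
          FractionRing (MvPolynomial (Fin s) k) →+* _).toAlgebra
      haveI : Algebra.IsIntegral (FractionRing (MvPolynomial (Fin s) k))
          (Localization ((nonZeroDivisors (MvPolynomial (Fin s) k)).map (algebraMap (MvPolynomial (Fin s) k) A)) ⧸
            𝔭.map (algebraMap A (Localization ((nonZeroDivisors (MvPolynomial (Fin s) k)).map
              (algebraMap (MvPolynomial (Fin s) k) A))))) :=
        algebraMap_isIntegral_iff.mp hint
      exact isField_of_isIntegral_of_isField' (Field.toIsField (FractionRing (MvPolynomial (Fin s) k)))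
    exact Ideal.Quotient.maximal_of_isField _ hQ
  · -- `A[M⁻¹]` is of finite type over `K₀ = Frac P` (localisation of the finite-type `P → A`)
    have hPA : (algebraMap (MvPolynomial (Fin s) k) A).FiniteType := by
      rw [RingHom.finiteType_algebraMap]
      exact Algebra.FiniteType.of_restrictScalars_finiteType k (MvPolynomial (Fin s) k) A
    have hft' := RingHom.finiteType_localizationPreserves (algebraMap (MvPolynomial (Fin s) k) A)
      (nonZeroDivisors (MvPolynomial (Fin s) k)) (FractionRing (MvPolynomial (Fin s) k))
      (Localization ((nonZeroDivisors (MvPolynomial (Fin s) k)).map (algebraMap (MvPolynomial (Fin s) k) A))) hPA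
    exact ⟨FractionRing (MvPolynomial (Fin s) k), inferInstance, inferInstance,
      (IsLocalization.map (Localization ((nonZeroDivisors (MvPolynomial (Fin s) k)).map
        (algebraMap (MvPolynomial (Fin s) k) A))) (algebraMap (MvPolynomial (Fin s) k) A)
        ((nonZeroDivisors (MvPolynomial (Fin s) k)).le_comap_map) : FractionRing (MvPolynomial (Fin s) k) →+* _).toAlgebra,
      hft'⟩

end Summit.ResolutionOfSingularities.ResolutionOfSingularities.Theorems.FInjectiveMacaulayfication.GenericFibreLocalization

end
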